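import Mathlib
import HarnessLib
import Summits.NavierStokesRegularity.NavierStokesRegularity.Theorems.QuarterLogPincerColdSmoothingDefs
import Summits.NavierStokesRegularity.NavierStokesRegularity.Theorems.QuarterLogPincerBeadCensusKernel
import Summits.NavierStokesRegularity.NavierStokesRegularity.Theorems.QuarterLogPincerEmberCensusKernel
import Summits.NavierStokesRegularity.NavierStokesRegularity.Theorems.QuarterLogPincerTypeIQuantSubcubicExpStubUniformScaledEnergy
import Summits.NavierStokesRegularity.NavierStokesRegularity.Theorems.QuarterLogPincerTypeIQuantSubcubicExpFrameTools
import Literature.Analysis.FluidPDE.PressureDecayEstimateProofs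
import Literature.Analysis.FluidPDE.SereginEpsilonRegularityHigherHolds
import Literature.Analysis.FluidPDE.ChaeAsymptoticallySelfSimilarSmallness
import Literature.Analysis.FluidPDE.ClassicalTopPointCubic

/-!
# Route `QuarterLogPincer`, crux `TypeIQuantSubcubicExp` (stmt-NavierStokesRegularity-24077), line `cold_smoothing` —
# the line's PROVED KERNEL by name, part 1: cold cylinders are quantitatively regular; E1b ⟸ CS1–CS3

VERBATIM port (bodies byte-identical up to the unfolding of `E3`) of the sorry-free theorems of `Cruxes/TypeIQuantSubcubicExp/Lines/cold_smoothing.lean`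
v1.1 (tree sha16 4ab89edcbc8c8689; idea-crit-4 PASS), §2–§3: `coldRegularity_of_stubs` (one pressure step: CS1 `ColdCube` + CS2 `ColdPressureGauge` +
CS3 `SmallEnergySmoothing` ⇒ the quantitative regularity package on cold cylinders), `scale_bound`, ★ `hotWitnessNear_of_stubs : ColdCube →
ColdPressureGauge → SmallEnergySmoothing → EmberCensus.HotWitnessNear` (E1b of `ember_census` ⟸ CS1–CS3).  Part 2 (`…ColdSmoothingAftermath`) carries
§R/§5 (Sa♭ ⟸ CS1–CS3, E2♭ kernel); the by-name products are in `…ColdSmoothingAssembly`.  The three stubs are NOT proved here.  HONEST FRAME: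
implications between Props about HYPOTHETICAL Type-I classical solutions over tree theorems (I1, ε-regularity, pressure decay); CS1–CS3 OPEN;
nothing here bears on 24077's truth, W7 or Navier–Stokes regularity (OPEN / not proved).  pub-ns-dss typer (g38),
`--supports stmt-NavierStokesRegularity-24077`; bodies by ns-idea-7 (g13).
-/

set_option linter.dupNamespace false

noncomputable section

open MeasureTheory Set Function Filter Topology Metric
open scoped ENNReal NNReal Classical
open Literature.Analysis Literature.Analysis.FluidPDE
open Summit.NavierStokesRegularity.NavierStokesRegularity.Theorems.ThinCascade
open Summit.NavierStokesRegularity.NavierStokesRegularity.Cruxes.TypeIQuantSubcubicExp.BeadCensus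
open Summit.NavierStokesRegularity.NavierStokesRegularity.Cruxes.TypeIQuantSubcubicExp.EmberCensus
  (Hot Terminal HotWitnessNear TerminalEmberM)
open Summit.NavierStokesRegularity.NavierStokesRegularity.Cruxes.TypeIQuantSubcubicExp.SilencingCost
  (BoxBound boxBound_mono RegularAftermath VorticalCentre EnstrophyPersistence EmberReadout)

namespace Summit.NavierStokesRegularity.NavierStokesRegularity.Cruxes.TypeIQuantSubcubicExp.ColdSmoothing

/-- **Cold regularity package** (PROVED from CS1–CS3 and the tree's `seregin_sverak_pressure_decay_holds`): for
`M ≥ 1` there are `ε₁(M) > 0`, `θ(M) ∈ (0,1]`, `c⋆ ≥ 1` such that an `ε`-cold cylinder `Q_ρ(z)` (`ε ≤ ε₁`,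
`ρ² ≤ z₁ ≤ T`) of a frame solution with rate `M` carries `‖∇ʲu‖ ≤ c⋆(θρ)^{-(j+1)}` on
`[z₁ − (θρ/2)², z₁] × B(z₂, θρ/2)`, `j ≤ 2`. -/
theorem coldRegularity_of_stubs (h1 : ColdCube) (h2 : ColdPressureGauge) (h3 : SmallEnergySmoothing) :
    ∀ M : ℝ, 1 ≤ M → ∃ ε₁ θ cs : ℝ, 0 < ε₁ ∧ 0 < θ ∧ θ ≤ 1 ∧ 1 ≤ cs ∧
      ∀ (T τ : ℝ) (u : ℝ → (EuclideanSpace ℝ (Fin 3)) → (EuclideanSpace ℝ (Fin 3))) (p : ℝ → (EuclideanSpace ℝ (Fin 3)) → ℝ), Frame T u p → 0 < τ → Rate M T τ u →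
        ∀ (ε : ℝ) (z : ℝ × (EuclideanSpace ℝ (Fin 3))) (ρ : ℝ), 0 ≤ ε → ε ≤ ε₁ → 0 < ρ → ρ ^ 2 ≤ z.1 → z.1 ≤ T →
          ColdOn ε (T + τ) u (parabolicCylinder ρ z) →
          ∀ t ∈ Icc (z.1 - (θ * ρ / 2) ^ 2) z.1, ∀ x ∈ ball z.2 (θ * ρ / 2), ∀ j : ℕ, j ≤ 2 →
            ‖iteratedFDeriv ℝ j (u t) x‖ ≤ cs * (θ * ρ) ^ (-((j : ℝ) + 1)) := by
  intro M hM
  obtain ⟨C₁, hC₁, H1⟩ := h1 M hM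
  obtain ⟨C₂, hC₂, H2⟩ := h2 M hM
  obtain ⟨εs, cs, hεs, hcs, H3⟩ := h3
  obtain ⟨c, Hc⟩ := seregin_sverak_pressure_decay_holds
  set K : ℝ := (c : ℝ) + 1 with hK
  have hc0 : 0 ≤ (c : ℝ) := c.coe_nonneg
  have hK1 : 1 ≤ K := by rw [hK]; linarith
  have hK0 : 0 < K := by linarith
  -- the ratio `θ(M)` and the cap `ε₁(M)`
  set θ : ℝ := min (1 / 2) (εs / (4 * K * C₂)) with hθ
  have hθpos : 0 < θ := by
    rw [hθ]; refine lt_min (by norm_num) ?_; positivity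
  have hθhalf : θ ≤ 1 / 2 := min_le_left _ _
  have hθ1 : θ ≤ 1 := hθhalf.trans (by norm_num)
  have hθC₂ : θ * (4 * K * C₂) ≤ εs := by
    have : θ ≤ εs / (4 * K * C₂) := min_le_right _ _
    rwa [le_div_iff₀ (by positivity)] at this
  set ε₁ : ℝ := εs * θ ^ 2 / (4 * K * C₁) with hε₁
  have hε₁pos : 0 < ε₁ := by rw [hε₁]; positivity
  refine ⟨ε₁, θ, cs, hε₁pos, hθpos, hθ1, hcs, ?_⟩
  intro T τ u p hframe hτ hrate ε z ρ hε hεle hρ hρz hzT hcold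
  -- the smaller cylinder `Q_{θρ}(z)` is cold too
  have hθρ : 0 < θ * ρ := mul_pos hθpos hρ
  have hθρle : θ * ρ ≤ ρ := by nlinarith
  have hsub : parabolicCylinder (θ * ρ) z ⊆ parabolicCylinder ρ z := parabolicCylinder_mono hθρ.le hθρle z
  have hcold' : ColdOn ε (T + τ) u (parabolicCylinder (θ * ρ) z) := coldOn_mono hcold hsub
  have hθρz : (θ * ρ) ^ 2 ≤ z.1 := le_trans (by nlinarith) hρz
  -- CS1 at both scales, CS2 at scale `ρ`
  have hC_small : cknC (θ * ρ) z u ≤ ENNReal.ofReal (C₁ * ε) :=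
    H1 T τ u p hframe hτ hrate ε z (θ * ρ) hε hθρ hθρz hzT hcold'
  have hC_big : cknC ρ z u ≤ ENNReal.ofReal (C₁ * ε) := H1 T τ u p hframe hτ hrate ε z ρ hε hρ hρz hzT hcold
  obtain ⟨hball, hD⟩ := H2 T τ u p hframe hτ hrate z ρ hρ hρz hzT
  set q : ℝ → (EuclideanSpace ℝ (Fin 3)) → ℝ := ballGauge p z.2 ρ with hq
  have hIn : IsSuitableWeakSolutionInBall (θ * ρ) z u q := hball (θ * ρ) hθρ hθρle
  have hInρ : IsSuitableWeakSolutionInBall ρ z u q := hball ρ hρ le_rfl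
  -- ONE pressure-decay step (tree theorem, Seregin–Šverák (as13))
  have hdist : IsDistributionalNSSolutionOn (parabolicCylinderOpens ρ z) 1 0 u q := hInρ.1.distributional
  have hstep := Hc (parabolicCylinderOpens ρ z) u q hdist z ρ (θ * ρ) hθρ hθρle (fun w hw => hw)
  have hratio : θ * ρ / ρ = θ := by field_simp
  have hratio' : (ρ / (θ * ρ)) ^ 2 = 1 / θ ^ 2 := by field_simp
  rw [hratio, hratio'] at hstep
  -- assemble the smallness `C(θρ) + D(θρ) < ε⋆`
  have hA : C₁ * ε ≤ εs / 16 := by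
    have h1' : C₁ * ε ≤ C₁ * ε₁ := mul_le_mul_of_nonneg_left hεle hC₁.le
    have h2' : C₁ * ε₁ = εs * θ ^ 2 / (4 * K) := by rw [hε₁]; field_simp
    have h3' : εs * θ ^ 2 / (4 * K) ≤ εs * (1 / 2) ^ 2 / (4 * 1) := by
      apply div_le_div₀ (by positivity) ?_ (by norm_num) (by linarith)
      exact mul_le_mul_of_nonneg_left (pow_le_pow_left₀ hθpos.le hθhalf 2) hεs.le
    linarith
  have hB : (c : ℝ) * (θ * C₂) ≤ εs / 4 := by
    have : (c : ℝ) * (θ * C₂) ≤ K * (θ * C₂) := mul_le_mul_of_nonneg_right (by linarith) (by positivity)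
    nlinarith
  have hC : (c : ℝ) * (1 / θ ^ 2 * (C₁ * ε)) ≤ εs / 4 := by
    have h1' : 1 / θ ^ 2 * (C₁ * ε) ≤ 1 / θ ^ 2 * (C₁ * ε₁) :=
      mul_le_mul_of_nonneg_left (mul_le_mul_of_nonneg_left hεle hC₁.le) (by positivity)
    have h2' : 1 / θ ^ 2 * (C₁ * ε₁) = εs / (4 * K) := by rw [hε₁]; field_simp
    have h3' : (c : ℝ) * (εs / (4 * K)) ≤ K * (εs / (4 * K)) :=
      mul_le_mul_of_nonneg_right (by linarith) (by positivity)
    have h4' : K * (εs / (4 * K)) = εs / 4 := by field_simp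
    calc (c : ℝ) * (1 / θ ^ 2 * (C₁ * ε)) ≤ (c : ℝ) * (εs / (4 * K)) := by
          apply mul_le_mul_of_nonneg_left (h1'.trans h2'.le) hc0
      _ ≤ εs / 4 := by linarith
  have hsmall : cknC (θ * ρ) z u + cknD (θ * ρ) z q < ENNReal.ofReal εs := by
    have hCε : 0 ≤ C₁ * ε := mul_nonneg hC₁.le hε
    have hD' : cknD (θ * ρ) z q ≤
        ENNReal.ofReal ((c : ℝ) * (θ * C₂ + 1 / θ ^ 2 * (C₁ * ε))) := by
      refine hstep.trans ?_
      have e1 : ENNReal.ofReal θ * cknD ρ z q ≤ ENNReal.ofReal (θ * C₂) := by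
        rw [ENNReal.ofReal_mul hθpos.le]
        gcongr
      have e2 : ENNReal.ofReal (1 / θ ^ 2) * cknC ρ z u ≤ ENNReal.ofReal (1 / θ ^ 2 * (C₁ * ε)) := by
        rw [ENNReal.ofReal_mul (by positivity)]
        gcongr
      calc (c : ℝ≥0∞) * (ENNReal.ofReal θ * cknD ρ z q + ENNReal.ofReal (1 / θ ^ 2) * cknC ρ z u)
          ≤ (c : ℝ≥0∞) * (ENNReal.ofReal (θ * C₂) + ENNReal.ofReal (1 / θ ^ 2 * (C₁ * ε))) := by
            gcongr (c : ℝ≥0∞) * ?_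
            exact add_le_add e1 e2
        _ = ENNReal.ofReal ((c : ℝ) * (θ * C₂ + 1 / θ ^ 2 * (C₁ * ε))) := by
            rw [← ENNReal.ofReal_add (by positivity) (by positivity), ← ENNReal.ofReal_coe_nnreal,
              ← ENNReal.ofReal_mul hc0]
    calc cknC (θ * ρ) z u + cknD (θ * ρ) z q
        ≤ ENNReal.ofReal (C₁ * ε) + ENNReal.ofReal ((c : ℝ) * (θ * C₂ + 1 / θ ^ 2 * (C₁ * ε))) :=
          add_le_add hC_small hD'
      _ = ENNReal.ofReal (C₁ * ε + (c : ℝ) * (θ * C₂ + 1 / θ ^ 2 * (C₁ * ε))) := by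
          rw [← ENNReal.ofReal_add hCε (by positivity)]
      _ < ENNReal.ofReal εs := by
          rw [ENNReal.ofReal_lt_ofReal_iff hεs]
          nlinarith [mul_add (c : ℝ) (θ * C₂) (1 / θ ^ 2 * (C₁ * ε))]
  -- ε-regularity with all derivatives at scale `θρ`
  exact H3 T u p q hframe z (θ * ρ) hθρ hθρz hzT hIn hsmall

/-- Scale algebra: `c⋆ (θΓ√s)^{-(j+1)} ≤ M^{-3μ} s^{-(j+1)/2}` once `θΓ ≥ c⋆M^{3μ} + 1`. -/
theorem scale_bound {cs θ Γ s M μ : ℝ} (hcs : 1 ≤ cs) (_hθ : 0 < θ) (hs : 0 < s) (hM : 1 ≤ M) (hμ : 0 < μ)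
    (hΓ : cs * M ^ (3 * μ) + 1 ≤ θ * Γ) (j : ℕ) :
    cs * (θ * (Γ * Real.sqrt s)) ^ (-((j : ℝ) + 1)) ≤ M ^ (-(3 * μ)) * s ^ (-(((j : ℝ) + 1) / 2)) := by
  have hM0 : 0 < M := by linarith
  have hMμ : 1 ≤ M ^ (3 * μ) := Real.one_le_rpow hM (by linarith)
  have hL : 1 ≤ θ * Γ := by nlinarith
  have hθΓ0 : 0 < θ * Γ := by linarith
  have hsq : 0 < Real.sqrt s := Real.sqrt_pos.2 hs
  -- split the power
  have hsplit : (θ * (Γ * Real.sqrt s)) ^ (-((j : ℝ) + 1)) =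
      (θ * Γ) ^ (-((j : ℝ) + 1)) * s ^ (-(((j : ℝ) + 1) / 2)) := by
    rw [show θ * (Γ * Real.sqrt s) = (θ * Γ) * Real.sqrt s by ring,
      Real.mul_rpow hθΓ0.le hsq.le, Real.sqrt_eq_rpow, ← Real.rpow_mul hs.le]
    congr 2; ring
  rw [hsplit, ← mul_assoc]
  refine mul_le_mul_of_nonneg_right ?_ (Real.rpow_nonneg hs.le _)
  -- `cs (θΓ)^{-(j+1)} ≤ M^{-3μ}`
  have hpow : cs * M ^ (3 * μ) ≤ (θ * Γ) ^ ((j : ℝ) + 1) := by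
    have e : ((j : ℝ) + 1) = ((j + 1 : ℕ) : ℝ) := by push_cast; ring
    rw [e, Real.rpow_natCast]
    exact (le_trans (by linarith) (le_self_pow₀ hL (Nat.succ_ne_zero j)))
  have hP0 : 0 < (θ * Γ) ^ ((j : ℝ) + 1) := Real.rpow_pos_of_pos hθΓ0 _
  have hQ0 : 0 < cs * M ^ (3 * μ) := by positivity
  rw [Real.rpow_neg hθΓ0.le, Real.rpow_neg hM0.le]
  calc cs * ((θ * Γ) ^ ((j : ℝ) + 1))⁻¹ = cs / (θ * Γ) ^ ((j : ℝ) + 1) := by rw [div_eq_mul_inv]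
    _ ≤ cs / (cs * M ^ (3 * μ)) := div_le_div_of_nonneg_left (by linarith) hQ0 hpow
    _ = (M ^ (3 * μ))⁻¹ := by field_simp

/-- **E1b from the stubs** (KERNEL): the clock-near hot witness. -/
theorem hotWitnessNear_of_stubs (h1 : ColdCube) (h2 : ColdPressureGauge) (h3 : SmallEnergySmoothing) :
    HotWitnessNear := by
  intro μ M ε₀ hμ hM hε₀
  obtain ⟨ε₁, θ, cs, hε₁, hθ, hθ1, hcs, HR⟩ := coldRegularity_of_stubs h1 h2 h3 M hM
  have hM0 : 0 < M := by linarith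
  have hMμ : 1 ≤ M ^ (3 * μ) := Real.one_le_rpow hM (by linarith)
  refine ⟨min ε₀ ε₁, lt_min hε₀ hε₁, min_le_left _ _, ?_⟩
  set Γ₁ : ℝ := (cs * M ^ (3 * μ) + 1) / θ with hΓ₁
  have hΓ₁θ : θ * Γ₁ = cs * M ^ (3 * μ) + 1 := by rw [hΓ₁]; field_simp
  have hΓ₁1 : 1 ≤ Γ₁ := by
    rw [hΓ₁, le_div_iff₀ hθ]; nlinarith
  refine ⟨Γ₁, hΓ₁1, ?_⟩
  intro Γ hΓ T τ u p hframe hτ hrate a t₁ x₀ k R ht₁ hroom hR₁ hR₂ hnear hviol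
  by_contra hno
  apply hviol
  intro t' ht' x hxR hxR' j hj
  -- the scale
  set s : ℝ := levelScale a t₁ (k + 1) with hs
  have hspos : 0 < s := by rw [hs, levelScale]; exact mul_pos ht₁.1 (Real.exp_pos _)
  set r : ℝ := Γ * Real.sqrt s with hr
  have hΓ1 : 1 ≤ Γ := hΓ₁1.trans hΓ
  have hsq : 0 < Real.sqrt s := Real.sqrt_pos.2 hspos
  have hrpos : 0 < r := mul_pos (by linarith) hsq
  have hsr : s ≤ r ^ 2 := by
    have : Real.sqrt s ≤ r := by rw [hr]; nlinarith
    calc s = Real.sqrt s ^ 2 := (Real.sq_sqrt hspos.le).symm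
      _ ≤ r ^ 2 := pow_le_pow_left₀ hsq.le this 2
  -- `Q_r(t',x)` is ε-cold, else an admissible hot event exists
  have hcold : ColdOn (min ε₀ ε₁) (T + τ) u (parabolicCylinder r (t', x)) := by
    intro w hw
    rw [parabolicCylinder, mem_prod, mem_Ioo, mem_ball] at hw
    obtain ⟨⟨hw1, hw2⟩, hw3⟩ := hw
    by_contra hhot
    push Not at hhot
    have hwy : ‖w.2 - x‖ < r := by rwa [← dist_eq_norm]
    apply hno
    refine ⟨w.2, w.1, ⟨?_, hhot⟩, ?_, ?_, ?_, ?_, ?_⟩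
    · -- room clause of `Hot`: `T+τ−w.1 ≤ w.1`
      nlinarith [ht'.1, ht'.2]
    · linarith [ht'.2]
    · nlinarith [ht'.1]
    · nlinarith [ht'.1, ht'.2]
    · have : ‖x - x₀‖ ≤ ‖w.2 - x₀‖ + ‖w.2 - x‖ := by
        calc ‖x - x₀‖ = ‖(w.2 - x₀) - (w.2 - x)‖ := by congr 1; abel
          _ ≤ ‖w.2 - x₀‖ + ‖w.2 - x‖ := norm_sub_le _ _
      linarith
    · have : ‖w.2 - x₀‖ ≤ ‖w.2 - x‖ + ‖x - x₀‖ := by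
        calc ‖w.2 - x₀‖ = ‖(w.2 - x) + (x - x₀)‖ := by congr 1; abel
          _ ≤ ‖w.2 - x‖ + ‖x - x₀‖ := norm_add_le _ _
      linarith
  -- cold regularity at vertex `(t',x)`, radius `r`
  have hrt' : r ^ 2 ≤ (t', x).1 := by
    show r ^ 2 ≤ t'; nlinarith [ht'.1]
  have ht'T : (t', x).1 ≤ T := by show t' ≤ T; linarith [ht'.2, ht₁.2]
  have hsq0 : 0 ≤ (θ * r / 2) ^ 2 := sq_nonneg _
  have hmem : t' ∈ Icc (t' - (θ * r / 2) ^ 2) t' := ⟨by linarith, le_rfl⟩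
  have hballx : x ∈ ball x (θ * r / 2) := mem_ball_self (by positivity)
  have hreg := HR T τ u p hframe hτ hrate (min ε₀ ε₁) (t', x) r (le_min hε₀.le hε₁.le) (min_le_right _ _)
    hrpos hrt' ht'T hcold t' hmem x hballx j hj
  refine hreg.trans ?_
  have hθΓ : cs * M ^ (3 * μ) + 1 ≤ θ * Γ := by
    rw [← hΓ₁θ]; exact mul_le_mul_of_nonneg_left hΓ hθ.le
  simpa [hr] using scale_bound hcs hθ hspos hM hμ hθΓ j

end Summit.NavierStokesRegularity.NavierStokesRegularity.Cruxes.TypeIQuantSubcubicExp.ColdSmoothing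

end
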